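import Summits.ValiantsHypothesis.ValiantsHypothesis.Theorems.BarrierLeverChowBenchmarkPairsPeelIterate
import Mathlib.LinearAlgebra.Matrix.ToLinearEquiv
import Mathlib.LinearAlgebra.FiniteDimensional.Lemmas

/-!
# Route BarrierLever — item 22038 `ChowBenchmarkPairs`, line `moore-peel`: the SUNFLOWER NO-GO for segment-moment matrices
# (a correction to the general-coordinate form of CONJECTURE GTN)

Helper file (`--supports stmt-ValiantsHypothesis-22038`; cell valiant-natproofs, rung V4, 𝒟-side benchmark of record;
seat val-np-p4 gen 22).  Closes NO item.

MEMO-g21 §0.3 phrased CONJECTURE GTN for an arbitrary number `k` of coordinates: «for generic `P` the `r_h × 2^k` segment-moment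
matrix (rows = subsets of size `≤ 2` of the `h` points) has every maximal minor through the column `∅` with at most `h` singleton
columns nonzero».  THIS FILE proves that the general-`k` form is FALSE and isolates the obstruction: a **SUNFLOWER** — more than
`n` columns `A ∪ {c_i}` with a common core `A` and distinct single-coordinate petals — makes the `n`-point segment-moment matrix
SINGULAR FOR EVERY TABLE (`det_eq_zero_of_sunflower`).  Mechanism: on a sunflower column every row is a combination of the `n`
point vectors `(P_{a,c_i})_i` — row `{a}` is `(|A|+1)!·P_a^A · P_{a,c_i}` (`segE_singleton_insert`), row `{a,b}` is
`α·P_{a,c_i} + β·P_{b,c_i}` with `α, β` independent of `i` (`segE_pair_insert`, `sfCoefA/B`), row `∅` vanishes — so `n+1` sunflower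
columns are linearly dependent (a kernel vector of the `n × (n+1)` matrix `P_{a,c_i}`, `LinearMap.ker_ne_bot_of_finrank_lt`, gives a
kernel vector of the whole matrix, `Matrix.exists_mulVec_eq_zero_iff`).  The singleton condition of GTN is the case `A = ∅`.

CONSEQUENCES (memo HOME/val-np-p4/g22/MEMO-tropical-peeling-and-collisions-valnp4-g22.md §2bis).  (i) In the REGISTERED frame `k = h`
(`ChowBenchmarkGTN.Stmt.gtn`, points = coordinates = `Fin h`) a nonempty core has at most `h − 1` petals, so the node is NOT affected;
all censuses of record had `k ≤ h + 1`.  (ii) For `k ≥ h + 2` the sunflower condition is necessary; it is not sufficient either: kit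
j312464 (exhaustive over the 732 875 sunflower-free families at `(h,k) = (3,5)`) finds exactly ten singular ones, the edge sets of the
complete bipartite graphs `K_{2,3}` (rows on the edge columns are `P_Xᵀ s P_Y`, `s` symmetric) — also vacuous at `k = h`.  (iii) The benchmark
window `W_h` has no sunflower with more than `k − |A| ≤ k ≈ 2 log₂ h` petals, so nothing here bears on `stub_segmentMeanValue`.

WHAT THIS IS NOT: no stub of the line is closed or refuted (the registered `stub_gtn` has `k = h`); nothing on crux
stmt-ValiantsHypothesis-14610 or on `VP` versus `VNP`.
-/

set_option linter.dupNamespace false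

namespace Summit.ValiantsHypothesis.ValiantsHypothesis.Theorems.BarrierLever.ChowBenchmarkPeel

open Finset

variable {κ : Type*} [DecidableEq κ]
variable {F : Type*} [CommRing F] {n : ℕ}

/-! ## 1. Rows on a sunflower column `A ∪ {c}` are combinations of the point coordinates `P_{·,c}` -/

/-- Row `{a}` at the column `A ∪ {c}`: `P_{a,c} · ((|A|+1)!·P_a^A)`. -/
theorem segE_singleton_insert (P : Fin n → κ → F) (a : Fin n) (A : Finset κ) (c : κ) (hc : c ∉ A) :
    segE P {a} (insert c A) = P a c * ((((A.card + 1).factorial : ℕ) : F) * ∏ c' ∈ A, P a c') := by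
  rw [segE_singleton, Finset.card_insert_of_notMem hc, Finset.prod_insert hc]
  ring

/-- The coefficient of `P_{a,c}` in the pair row `{a,b}` at `A ∪ {c}` (the petal goes to `a`). -/
def sfCoefA (P : Fin n → κ → F) (a b : Fin n) (A : Finset κ) : F :=
  ∑ d ∈ A.powerset, (((d.card + 1).factorial : ℕ) : F) * (((A \ d).card.factorial : ℕ) : F) *
    ((∏ c' ∈ d, P a c') * ∏ c' ∈ A \ d, P b c')

/-- The coefficient of `P_{b,c}` in the pair row `{a,b}` at `A ∪ {c}` (the petal goes to `b`). -/
def sfCoefB (P : Fin n → κ → F) (a b : Fin n) (A : Finset κ) : F :=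
  ∑ d ∈ A.powerset, ((d.card.factorial : ℕ) : F) * ((((A \ d).card + 1).factorial : ℕ) : F) *
    ((∏ c' ∈ d, P a c') * ∏ c' ∈ A \ d, P b c')

/-- Row `{a,b}` at the column `A ∪ {c}`: `P_{a,c}·α + P_{b,c}·β` with `α = sfCoefA`, `β = sfCoefB` independent of `c`. -/
theorem segE_pair_insert (P : Fin n → κ → F) (a b : Fin n) (hab : a ≠ b) (A : Finset κ) (c : κ) (hc : c ∉ A) :
    segE P {a, b} (insert c A) = P a c * sfCoefA P a b A + P b c * sfCoefB P a b A := by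
  rw [segE_pair P a b hab, Finset.sum_powerset_insert hc, sfCoefA, sfCoefB, Finset.mul_sum, Finset.mul_sum, add_comm]
  congr 1
  · -- subsets `insert c d`, `d ⊆ A`: the petal goes to `a`
    refine Finset.sum_congr rfl fun d hd => ?_
    have hdA : d ⊆ A := Finset.mem_powerset.mp hd
    have hcd : c ∉ d := fun h => hc (hdA h)
    have h1 : insert c A \ insert c d = A \ d := by
      ext x
      simp only [Finset.mem_sdiff, Finset.mem_insert]
      constructor
      · rintro ⟨h | h, h'⟩
        · exact absurd (Or.inl h) h'
        · exact ⟨h, fun h'' => h' (Or.inr h'')⟩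
      · rintro ⟨h, h'⟩
        refine ⟨Or.inr h, ?_⟩
        rintro (h'' | h'')
        · exact hc (h'' ▸ h)
        · exact h' h''
    rw [h1, Finset.card_insert_of_notMem hcd, Finset.prod_insert hcd]
    ring
  · -- subsets `d ⊆ A`: the petal goes to `b`
    refine Finset.sum_congr rfl fun d hd => ?_
    have hdA : d ⊆ A := Finset.mem_powerset.mp hd
    have hcd : c ∉ A \ d := fun h => hc (Finset.mem_sdiff.mp h).1
    have h1 : insert c A \ d = insert c (A \ d) := by
      ext x
      simp only [Finset.mem_sdiff, Finset.mem_insert]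
      constructor
      · rintro ⟨h | h, h'⟩
        · exact Or.inl h
        · exact Or.inr ⟨h, h'⟩
      · rintro (h | ⟨h, h'⟩)
        · exact ⟨Or.inl h, fun h'' => hc (hdA (h ▸ h''))⟩
        · exact ⟨Or.inr h, h'⟩
    rw [h1, Finset.card_insert_of_notMem hcd, Finset.prod_insert hcd]
    ring

/-- Every row `S` (`|S| ≤ 2`) at a sunflower column is a combination of the point coordinates at the petal:
`segE P S (A ∪ {c}) = Σ_{a} κ_S(a) · P_{a,c}` with coefficients `κ_S` independent of `c`. -/
theorem segE_insert_eq_sum (P : Fin n → κ → F) (S : Row n) (A : Finset κ) :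
    ∃ coef : Fin n → F, ∀ c, c ∉ A → segE P S.1 (insert c A) = ∑ a, coef a * P a c := by
  classical
  obtain ⟨S, hS⟩ := S
  rcases Nat.lt_or_ge S.card 1 with h0 | h1
  · -- `S = ∅`
    have hc0 : S.card = 0 := by omega
    have hS0 : S = ∅ := Finset.card_eq_zero.mp hc0
    refine ⟨fun _ => 0, fun c _ => ?_⟩
    subst hS0
    rw [segE_empty, if_neg (Finset.insert_ne_empty c A)]
    simp
  · rcases Nat.lt_or_ge S.card 2 with h1' | h2
    · -- `S = {a}`
      have hc1 : S.card = 1 := by omega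
      obtain ⟨a, ha⟩ := Finset.card_eq_one.mp hc1
      refine ⟨fun a' => if a' = a then (((A.card + 1).factorial : ℕ) : F) * ∏ c' ∈ A, P a c' else 0, fun c hc => ?_⟩
      subst ha
      rw [segE_singleton_insert P a A c hc]
      simp only [ite_mul, zero_mul, Finset.sum_ite_eq', Finset.mem_univ, if_true]
      ring
    · -- `S = {a, b}`
      have hc2 : S.card = 2 := by omega
      obtain ⟨a, b, hab, hab'⟩ := Finset.card_eq_two.mp hc2
      refine ⟨fun a' => (if a' = a then sfCoefA P a b A else 0) + (if a' = b then sfCoefB P a b A else 0),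
        fun c hc => ?_⟩
      subst hab'
      rw [segE_pair_insert P a b hab A c hc]
      simp only [add_mul, Finset.sum_add_distrib, ite_mul, zero_mul, Finset.sum_ite_eq', Finset.mem_univ, if_true]
      ring

/-! ## 2. The sunflower no-go -/

section NoGo

variable {F : Type*} [Field F] {n : ℕ}

/-- **SUNFLOWER NO-GO.**  If the column family contains `n+1` columns `A ∪ {c_i}` (common core `A`, petals `c_i ∉ A`) at
distinct column indices, then the `n`-point segment-moment matrix is singular for EVERY table. -/
theorem det_eq_zero_of_sunflower (P : Fin n → κ → F) (col : Row n → Finset κ) (A : Finset κ)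
    (c : Fin (n + 1) → κ) (hcA : ∀ i, c i ∉ A) (e : Fin (n + 1) → Row n) (he : Function.Injective e)
    (hcol : ∀ i, col (e i) = insert (c i) A) :
    (Matrix.of fun S S' : Row n => segE P S.1 (col S')).det = 0 := by
  classical
  -- a kernel vector of the `n × (n+1)` matrix of petal coordinates
  set W : Matrix (Fin n) (Fin (n + 1)) F := Matrix.of fun a i => P a (c i) with hW
  have hker : LinearMap.ker (Matrix.mulVecLin W) ≠ ⊥ :=
    LinearMap.ker_ne_bot_of_finrank_lt (by simp)
  obtain ⟨v, hv, hv0⟩ := Submodule.exists_mem_ne_zero_of_ne_bot hker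
  rw [LinearMap.mem_ker, Matrix.mulVecLin_apply] at hv
  have hva : ∀ a : Fin n, ∑ i, P a (c i) * v i = 0 := by
    intro a
    have := congrFun hv a
    rw [Matrix.mulVec, Pi.zero_apply] at this
    simpa [dotProduct, hW] using this
  -- lift it to the column index set
  set w : Row n → F := fun S' => ∑ i, if e i = S' then v i else 0 with hw
  apply Matrix.exists_mulVec_eq_zero_iff.mp
  refine ⟨w, ?_, ?_⟩
  · intro hw0
    apply hv0
    funext i
    have h1 : w (e i) = 0 := by rw [hw0, Pi.zero_apply]
    have h2 : w (e i) = v i := by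
      simp only [hw]
      rw [Finset.sum_eq_single i (fun j _ hj => if_neg (fun h => hj (he h)))
        (fun h => absurd (Finset.mem_univ i) h), if_pos rfl]
    rw [Pi.zero_apply, ← h2, h1]
  · funext S
    rw [Matrix.mulVec, Pi.zero_apply, dotProduct]
    -- `Σ_{S'} M S S' · w S' = Σ_i v_i · M S (e i)`
    have hswap : (∑ S', (Matrix.of fun S S' : Row n => segE P S.1 (col S')) S S' * w S') =
        ∑ i, v i * segE P S.1 (col (e i)) := by
      simp only [hw, Matrix.of_apply, Finset.mul_sum, mul_ite, mul_zero]
      rw [Finset.sum_comm]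
      refine Finset.sum_congr rfl fun i _ => ?_
      rw [Finset.sum_ite_eq Finset.univ (e i), if_pos (Finset.mem_univ _), mul_comm]
    rw [hswap]
    obtain ⟨coef, hcoef⟩ := segE_insert_eq_sum P S A
    simp_rw [hcol, fun i => hcoef (c i) (hcA i), Finset.mul_sum]
    rw [Finset.sum_comm]
    refine Finset.sum_eq_zero fun a _ => ?_
    have : (∑ i, v i * (coef a * P a (c i))) = coef a * ∑ i, P a (c i) * v i := by
      rw [Finset.mul_sum]
      exact Finset.sum_congr rfl fun i _ => by ring
    rw [this, hva a, mul_zero]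

end NoGo

end Summit.ValiantsHypothesis.ValiantsHypothesis.Theorems.BarrierLever.ChowBenchmarkPeel
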